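import Summits.CriticalPhenomena.PercolationContinuityZ3.Theorems.PercNonProliferationFreeBoxSparseStubCollarMerge
import Literature.Probability.Percolation.SiteConnectionTools
import Mathlib.Data.Finset.Sym
import HarnessLib

/-!
# Crux `PercNonProliferation.FreeBoxSparse` (stmt-CriticalPhenomena-4445), line `ccfs-window-kissing-walls` —
# helper for stub `stub_collar`, part 3: lattice geometry of the template (residue tilings of `ℤ^d`)

Helper file for the lead's skeleton of line `ccfs-window-kissing-walls`
(prover-line-stmt-CriticalPhenomena-4445-0); lands with `--supports stmt-CriticalPhenomena-4445`.

Balls and their connectivity, and the good-blocks lemma of the sprinkling argument.  The `r`-ball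
`B_r(a) = box 3 r + a` in coordinates (`mem_ball_iff`, `supDist_le_iff`); every ball is
lattice-connected (`pathIn_ball`, from the tree's `box_induce_reachable`), so a ball all of whose
lattice edges are open joins any two of its vertices inside any `Λ ⊇ ball`
(`mem_openConnIn_of_ball_open`).  `stub_collar_goodblocks` (registered, abstract in the tile map
`t` of the template): if `x, y ∈ Λ` carry `δ`-dense free pieces NOT joined inside `Λ` under `κ`, and
`S ⊆ Λ` is a set of centres of doubly-met interior balls on which `t` is injective and whose balls
are level sets of `t` (ball = tile), then the `|S|` tiles `t(a)`, `a ∈ S`, are good blocks: the block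
`U k` (lattice edges inside `Λ ∩ {t = k}`) is NOT inside `κ` (else the ball would join the two
pieces), and `κ ∪ U k` joins them, raising the free volume functional `π_Λ = N_Λ/|Λ|²` by `≥ 2δ²`
(the merging increment `stub_collar_merge` of part 3).
-/

noncomputable section

namespace Summit.CriticalPhenomena.PercolationContinuityZ3.Theorems.FreeBoxSparse

namespace StubCollar

open Finset
open Literature.Probability.Percolation Literature.Probability.LatticeModels

variable {d : ℕ}

/-! ### Balls -/

/-- The `r`-ball `B_r(a) = box d r + a` in coordinates. [folklore] -/
theorem mem_ball_iff (r : ℕ) (a w : Site d) :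
    w ∈ (box d r).image (· + a) ↔ ∀ j, -(r : ℤ) ≤ w j - a j ∧ w j - a j ≤ r := by
  constructor
  · intro hw
    obtain ⟨b, hb, rfl⟩ := Finset.mem_image.1 hw
    rw [mem_box] at hb
    intro j
    have := hb j
    simp only [Pi.add_apply]
    constructor <;> omega
  · intro h
    refine Finset.mem_image.2 ⟨w - a, ?_, sub_add_cancel w a⟩
    rw [mem_box]
    intro j
    have := h j
    simp only [Pi.sub_apply]
    constructor <;> omega

/-- Sup-distance `≤ r` in coordinates. [folklore] -/
theorem supDist_le_iff (r : ℕ) (a w : Site d) :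
    (Finset.univ.sup fun j : Fin d => (w j - a j).natAbs) ≤ r ↔
      ∀ j, -(r : ℤ) ≤ w j - a j ∧ w j - a j ≤ r := by
  rw [Finset.sup_le_iff]
  simp only [Finset.mem_univ, forall_true_left]
  refine forall_congr' fun j => ?_
  omega

/-- A vertex at sup-distance `≤ r` from `a` lies in the ball `B_r(a)`. [folklore] -/
theorem mem_ball_of_supDist_le (r : ℕ) (a w : Site d)
    (h : (Finset.univ.sup fun j : Fin d => (w j - a j).natAbs) ≤ r) :
    w ∈ (box d r).image (· + a) :=
  (mem_ball_iff r a w).2 ((supDist_le_iff r a w).1 h)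

/-! ### Balls are lattice-connected -/

/-- Reachability in an induced subgraph yields a path inside the inducing set. [folklore] -/
theorem pathIn_of_induce_reachable {V : Type*} {G : SimpleGraph V} {S : Set V} {x y : V}
    (hx : x ∈ S) (hy : y ∈ S) (h : (G.induce S).Reachable ⟨x, hx⟩ ⟨y, hy⟩) : PathIn G S x y := by
  rw [SimpleGraph.reachable_iff_reflTransGen] at h
  suffices key : ∀ b : S, Relation.ReflTransGen (G.induce S).Adj ⟨x, hx⟩ b → PathIn G S x b.1 from
    key ⟨y, hy⟩ h
  intro b hb
  induction hb with
  | refl => exact PathIn.refl hx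
  | @tail c e _ hce ih =>
    simp only [SimpleGraph.comap_adj, Function.Embedding.coe_subtype] at hce
    exact ih.tail hce e.2

/-- **Balls are connected**: any two sites of `B_r(a)` are joined by a lattice path inside `B_r(a)`
(the tree's `box_induce_reachable`, translated by `a`). [folklore] -/
theorem pathIn_ball (r : ℕ) (a : Site d) {u v : Site d} (hu : u ∈ (box d r).image (· + a))
    (hv : v ∈ (box d r).image (· + a)) :
    PathIn (zdGraph d) (↑((box d r).image (· + a)) : Set (Site d)) u v := by
  obtain ⟨u', hu', rfl⟩ := Finset.mem_image.1 hu
  obtain ⟨v', hv', rfl⟩ := Finset.mem_image.1 hv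
  have h := pathIn_of_induce_reachable (G := zdGraph d) (Finset.mem_coe.2 hu') (Finset.mem_coe.2 hv')
    (box_induce_reachable r hu' hv')
  refine DCT16.pathIn_map (· + a) ?_ ?_ h
  · intro b hb
    exact Finset.mem_coe.2 (Finset.mem_image_of_mem _ (Finset.mem_coe.1 hb))
  · intro b c _ _ hbc
    exact (zdGraph_adj_shift_iff a b c).2 hbc

/-- **An open ball is internally connected inside `Λ`.** If `B_r(a) ⊆ Λ` and every lattice edge with
both ends in `B_r(a)` is open in `ω`, then any two sites of `B_r(a)` are joined inside `Λ`. [folklore] -/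
theorem mem_openConnIn_of_ball_open (r : ℕ) (a : Site d) (Λ : Finset (Site d))
    (hball : (box d r).image (· + a) ⊆ Λ) (ω : BondConfig (Site d))
    (hopen : ∀ v w, v ∈ (box d r).image (· + a) → w ∈ (box d r).image (· + a) →
      (zdGraph d).Adj v w → s(v, w) ∈ ω)
    {u v : Site d} (hu : u ∈ (box d r).image (· + a)) (hv : v ∈ (box d r).image (· + a)) :
    ω ∈ openConnIn (↑Λ : Set (Site d)) u v := by
  have hp := pathIn_ball r a hu hv
  have hp' : PathIn (openGraph ω) (↑((box d r).image (· + a)) : Set (Site d)) u v :=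
    DCT16.pathIn_congrGraph (fun b c hb hc hbc =>
      (openGraph_adj ω b c).2 ⟨hopen b c (Finset.mem_coe.1 hb) (Finset.mem_coe.1 hc) hbc, hbc.ne⟩) hp
  exact DCT16.mem_openConnIn_of_pathIn (hp'.mono (Finset.coe_subset.2 hball))

end StubCollar

open Literature.Probability.Percolation Literature.Probability.LatticeModels
open scoped Classical

/-- **Registered: doubly-met interior balls are good blocks** (abstract in the tile map `t`). Let
`x, y ∈ Λ` carry `δ`-dense free pieces (`δ ≥ 0`) not joined inside `Λ` under the configuration `κ`;
let `S ⊆ Λ` consist of centres `a` of interior balls `B_r(a) ⊆ Λ` met by both pieces, such that every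
ball `B_r(a)`, `a ∈ S`, lies in the level set `{t = t a}` and `t` is injective on `S`. Then the tiles
`G = t(S)` (`|G| = |S|`) are good: for `k ∈ G` the block `U k` of lattice edges inside `Λ ∩ {t = k}`
is not contained in `κ`, and `π_Λ(κ ∪ U k) ≥ π_Λ(κ) + 2δ²`. [folklore] -/
theorem stub_collar_goodblocks : ∀ (Λ S : Finset (Site 3)) (r : ℕ) (t : Site 3 → Site 3) (δ : ℝ) (κ : Finset (Sym2 (Site 3))) (x y : Site 3), 0 ≤ δ → x ∈ Λ → y ∈ Λ → δ * (Λ.card : ℝ) ≤ (((Λ.filter fun v => (↑κ : Set (Sym2 (Site 3))) ∈ openConnIn ↑Λ x v)).card : ℝ) → δ * (Λ.card : ℝ) ≤ (((Λ.filter fun v => (↑κ : Set (Sym2 (Site 3))) ∈ openConnIn ↑Λ y v)).card : ℝ) → (↑κ : Set (Sym2 (Site 3))) ∉ openConnIn ↑Λ x y → S ⊆ Λ → (∀ a ∈ S, (box 3 r).image (· + a) ⊆ Λ ∧ (∃ u ∈ Λ, (Finset.univ.sup fun j : Fin 3 => (u j - a j).natAbs) ≤ r ∧ (↑κ : Set (Sym2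 (Site 3))) ∈ openConnIn ↑Λ x u) ∧ (∃ u ∈ Λ, (Finset.univ.sup fun j : Fin 3 => (u j - a j).natAbs) ≤ r ∧ (↑κ : Set (Sym2 (Site 3))) ∈ openConnIn ↑Λ y u)) → (∀ a ∈ S, ∀ w ∈ (box 3 r).image (· + a), t w = t a) → Set.InjOn t ↑S → ∃ G ⊆ Λ.image t, S.card ≤ G.card ∧ ∀ k ∈ G, ¬ ((Λ.filter fun w => t w = k).sym2.filter fun e => e ∈ (zdGraph 3).edgeSet) ⊆ κ ∧ (∑ v ∈ Λ, ((Λ.filter fun w => (↑κ : Set (Sym2 (Site 3))) ∈ openConnIn ↑Λ v w).card : ℝ)) / (Λ.card : ℝ) ^ 2 + 2 * δ ^ 2 ≤ (∑ v ∈ Λ, ((Λ.filter fun w => (↑(κ ∪ ((Λ.filter fun w => t w = k).sym2.filter fun e => e ∈ (zdGraph 3).edgeSet)) : Set (Sym2 (Site 3))) ∈ openConnIn ↑Λ v w).card : ℝ)) / (Λ.card : ℝ) ^ 2 := by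
  intro Λ S r t δ κ x y hδ hx hy hdx hdy hxy hSΛ hS htile hinj
  refine ⟨S.image t, Finset.image_subset_image hSΛ, (Finset.card_image_of_injOn hinj).symm.le, ?_⟩
  intro k hk
  obtain ⟨a, haS, rfl⟩ := Finset.mem_image.1 hk
  obtain ⟨hball, ⟨u, huΛ, hua, hxu⟩, ⟨u', hu'Λ, hu'a, hyu'⟩⟩ := hS a haS
  have hu : u ∈ (box 3 r).image (· + a) := StubCollar.mem_ball_of_supDist_le r a u hua
  have hu' : u' ∈ (box 3 r).image (· + a) := StubCollar.mem_ball_of_supDist_le r a u' hu'a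
  -- the lattice edges of the ball form (part of) the block of the tile of `a`
  have hedge : ∀ v w, v ∈ (box 3 r).image (· + a) → w ∈ (box 3 r).image (· + a) →
      (zdGraph 3).Adj v w → s(v, w) ∈ ((Λ.filter fun w => t w = t a).sym2.filter
        fun e => e ∈ (zdGraph 3).edgeSet) := by
    intro v w hv hw hvw
    rw [Finset.mem_filter, Finset.mk_mem_sym2_iff, Finset.mem_filter, Finset.mem_filter,
      SimpleGraph.mem_edgeSet]
    exact ⟨⟨⟨hball hv, htile a haS v hv⟩, ⟨hball hw, htile a haS w hw⟩⟩, hvw⟩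
  -- opening the ball joins `x` and `y` inside `Λ`
  have hjoin : ∀ ω' : BondConfig (Site 3), (↑κ : Set (Sym2 (Site 3))) ⊆ ω' →
      (∀ v w, v ∈ (box 3 r).image (· + a) → w ∈ (box 3 r).image (· + a) →
        (zdGraph 3).Adj v w → s(v, w) ∈ ω') → ω' ∈ openConnIn (↑Λ : Set (Site 3)) x y := by
    intro ω' hκω' hopen
    have huu' : ω' ∈ openConnIn (↑Λ : Set (Site 3)) u u' :=
      StubCollar.mem_openConnIn_of_ball_open r a Λ hball ω' hopen hu hu'
    exact StubCollar.openConnIn_trans' (StubCollar.openConnIn_of_subset hκω' hxu)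
      (StubCollar.openConnIn_trans' huu'
        (StubCollar.openConnIn_symm' (StubCollar.openConnIn_of_subset hκω' hyu')))
  refine ⟨?_, ?_⟩
  · intro hsub
    exact hxy (hjoin ↑κ subset_rfl fun v w hv hw hvw => Finset.mem_coe.2 (hsub (hedge v w hv hw hvw)))
  · -- the merging increment
    have hmerge := stub_collar_merge Λ (↑κ : Set (Sym2 (Site 3)))
      (↑(κ ∪ ((Λ.filter fun w => t w = t a).sym2.filter fun e => e ∈ (zdGraph 3).edgeSet)) :
        Set (Sym2 (Site 3)))
      (Finset.coe_subset.2 Finset.subset_union_left) x y hxy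
      (hjoin _ (Finset.coe_subset.2 Finset.subset_union_left) fun v w hv hw hvw =>
        Finset.mem_coe.2 (Finset.mem_union_right _ (hedge v w hv hw hvw)))
    have hN : (0 : ℝ) < (Λ.card : ℝ) ^ 2 := by
      have : (0 : ℝ) < Λ.card := Nat.cast_pos.2 (Finset.card_pos.2 ⟨x, hx⟩)
      exact pow_pos this 2
    have hprod : δ ^ 2 * (Λ.card : ℝ) ^ 2 ≤
        (((Λ.filter fun v => (↑κ : Set (Sym2 (Site 3))) ∈ openConnIn ↑Λ x v)).card : ℝ) *
          (((Λ.filter fun v => (↑κ : Set (Sym2 (Site 3))) ∈ openConnIn ↑Λ y v)).card : ℝ) := by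
      have h0 : 0 ≤ δ * (Λ.card : ℝ) := mul_nonneg hδ (Nat.cast_nonneg _)
      calc δ ^ 2 * (Λ.card : ℝ) ^ 2 = (δ * Λ.card) * (δ * Λ.card) := by ring
        _ ≤ _ := mul_le_mul hdx hdy h0 ((h0.trans hdx))
    rw [div_add' _ _ _ hN.ne', div_le_div_iff_of_pos_right hN]
    linarith

end Summit.CriticalPhenomena.PercolationContinuityZ3.Theorems.FreeBoxSparse
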